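import Summits.ResolutionOfSingularities.ResolutionOfSingularities.Theorems.FrobeniusLadderFInjectiveMacaulayficationFDStorey1Charts
import Summits.ResolutionOfSingularities.ResolutionOfSingularities.Theorems.FrobeniusLadderFInjectiveMacaulayficationCICertificates
import Summits.ResolutionOfSingularities.ResolutionOfSingularities.Theorems.FrobeniusLadderFInjectiveMacaulayficationDoublePointFermatCubicGerm
import Literature.AlgebraicGeometry.Resolution.BlowupsScaling
import HarnessLib

/-!
# BED D STOREY 1 — THE CENTRE `𝔪·K` ON `X_D`: zero locus (`I_A ≤ 𝔭 ↔ 𝔪_v ≤ 𝔭`), support `{v}`, `K ≠ ⊥`, `𝔪 ≠ ⊥`, `𝔪 ⊆ √K`, and the FIRST-STOREY BLOW-UP DATA of the two-storey glue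
# (`π₁ = affineBlowup.π (𝔪·K)` is a blowing up along `𝔪̃ · K̃ ≠ ⊥`, both supports meet the generizations of `v` only in `v`)
# (crux `FInjectiveMacaulayfication` stmt-ResolutionOfSingularities-15315, chain w45a; (W-TD) BED D storey 1 (D-1), res-L1-w45a-plan-1 R21.18 (4); seat res-L1-w45a-stub-2 g10)

Support file for crux stmt-ResolutionOfSingularities-15315 (`FrobeniusLadder.FInjectiveMacaulayfication`), chain w45a.
[OURS · L1 W4.5a] — NOT a statement of any manuscript; AI-written, weaker than expert review.

`R̄ = k[x,y,u,t,z]/(f_D)` (res-L1-w45a-stub-3's `FDSpecimen`), `I_A = span (x̄^A)` the certified centre, `= 𝔪·K` (`FDStorey1Fan.span_A_eq_floor_mul_K`), `K = span (x̄^(genSet 5 KL2))`.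
★ `storey1_isBlowup_data` — the hypotheses `hπ₁ hJ hsuppτ hsuppK` of res-L1-w45a-stub-1's `FHalfRowOfTwoStoreys.fHalfConclusion_of_twoStoreys` for `X = Spec R̄`, `x = v`,
`π₁ = affineBlowup.π (𝔪·K)`, `Jτ = 𝔪̃`, `JK = K̃` (Literature `affineBlowup.idealSheaf_mul`, `affineBlowup.isBlowup`). No definitions, no named facts.
[folklore; cite: StacksProject, Tag 0804; StacksProject, Tag 080A]
-/

-- single-problem summit: the doubled namespace component is forced
set_option linter.dupNamespace false

noncomputable section

open AlgebraicGeometry CategoryTheory Literature.AlgebraicGeometry.Resolution TopologicalSpace IsLocalRing MvPolynomial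

namespace Summit.ResolutionOfSingularities.ResolutionOfSingularities.Theorems.FInjectiveMacaulayfication.FDStorey1Centre

open Summit.ResolutionOfSingularities.ResolutionOfSingularities.Theorems.FInjectiveMacaulayfication
open SliceableCentre FanCheckKit FanCheckSound FDStorey1Fan FDStorey1Charts

variable (k : Type) [Field k] [CharP k 2]

omit [CharP k 2] in
/-- `I_A ≤ 𝔭 ↔ 𝔪_v ≤ 𝔭` for primes `𝔭` of `R̄` (the centre is `𝔪`-primary). [folklore] -/
theorem centre_le_iff (f : MvPolynomial (Fin 5) k) (P : Ideal (MvPolynomial (Fin 5) k ⧸ Ideal.span {f})) [P.IsPrime] :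
    Ideal.span ((fun e : Fin 5 →₀ ℕ => Ideal.Quotient.mk (Ideal.span {f}) (monomial e (1 : k))) '' (genSet 5 AL2 : Set (Fin 5 →₀ ℕ))) ≤ P ↔
      Ideal.span (Set.range fun j : Fin 5 => Ideal.Quotient.mk (Ideal.span {f}) (X j)) ≤ P := by
  rw [CICertificates.centre_le_iff (Ideal.span {f}) Finset.univ (genSet 5 AL2) hprimAJ.1 hprimAJ.2 P, Ideal.span_le, Set.range_subset_iff]
  exact ⟨fun h j => h j (Finset.mem_univ j), fun h j _ => h j⟩

/-! ## §5 The centre as the PRODUCT `𝔪·K`; support; the storey in the two-storey letter -/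

omit [CharP k 2] in
/-- **The support of the centre `Ĩ_A` is the vertex** (the monomial ideal is `𝔪`-primary). [folklore; cite: StacksProject, Tag 0804] -/
theorem support_idealSheaf (f : MvPolynomial (Fin 5) k) (hf : f = X 4 ^ 4 + X 0 ^ 5 * X 4 + X 0 ^ 6 + X 1 ^ 3 + X 2 ^ 3 + X 3 ^ 7)
    (v : Spec (.of (MvPolynomial (Fin 5) k ⧸ Ideal.span {f})))
    (hv : v.asIdeal = Ideal.span (Set.range fun j : Fin 5 => Ideal.Quotient.mk (Ideal.span {f}) (X j))) :
    ((affineBlowup.idealSheaf (Ideal.span ((fun e : Fin 5 →₀ ℕ => Ideal.Quotient.mk (Ideal.span {f}) (monomial e (1 : k))) ''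
        (genSet 5 AL2 : Set (Fin 5 →₀ ℕ))))).support : Set (Spec (.of (MvPolynomial (Fin 5) k ⧸ Ideal.span {f})))) = {v} := by
  have hmax : v.asIdeal.IsMaximal := by
    rw [hv]; exact DoublePointFermatCubicGerm.isMaximal_origin k f (FDSpecimen.constantCoeff_f k f hf)
  rw [affineBlowup.support_idealSheaf]
  ext w
  change ((Ideal.span ((fun e : Fin 5 →₀ ℕ => Ideal.Quotient.mk (Ideal.span {f}) (monomial e (1 : k))) ''
      (genSet 5 AL2 : Set (Fin 5 →₀ ℕ))) : Ideal (MvPolynomial (Fin 5) k ⧸ Ideal.span {f})) :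
      Set (MvPolynomial (Fin 5) k ⧸ Ideal.span {f})) ⊆ (w.asIdeal : Set (MvPolynomial (Fin 5) k ⧸ Ideal.span {f})) ↔ w = v
  rw [SetLike.coe_subset_coe, centre_le_iff]
  constructor
  · intro h
    exact PrimeSpectrum.ext (hmax.eq_of_le w.isPrime.ne_top (hv ▸ h)).symm
  · rintro rfl
    rw [hv]

/-- `K ≠ ⊥` in the domain `R̄`: a pure power of `x̄` lies in `K`. [folklore] -/
theorem span_K_ne_bot (f : MvPolynomial (Fin 5) k) (hf : f = X 4 ^ 4 + X 0 ^ 5 * X 4 + X 0 ^ 6 + X 1 ^ 3 + X 2 ^ 3 + X 3 ^ 7) :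
    Ideal.span ((fun e : Fin 5 →₀ ℕ => Ideal.Quotient.mk (Ideal.span {f}) (monomial e (1 : k))) '' (genSet 5 KL2 : Set (Fin 5 →₀ ℕ))) ≠ ⊥ := by
  intro h0
  have h := mk_X_mem_radical_span_K k (Ideal.span {f}) 0
  rw [h0] at h
  haveI := (isPrime_and_mk_X_ne_zero k f hf).1
  haveI : IsDomain (MvPolynomial (Fin 5) k ⧸ Ideal.span {f}) := Ideal.Quotient.isDomain _
  have h' : Ideal.Quotient.mk (Ideal.span {f}) (X 0 : MvPolynomial (Fin 5) k) ∈ nilradical (MvPolynomial (Fin 5) k ⧸ Ideal.span {f}) := h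
  rw [nilradical_eq_zero, Ideal.zero_eq_bot, Ideal.mem_bot] at h'
  exact (isPrime_and_mk_X_ne_zero k f hf).2 0 h'

/-- The floor centre `𝔪 ≠ ⊥` in the domain `R̄`. [folklore] -/
theorem span_floor_ne_bot (f : MvPolynomial (Fin 5) k) (hf : f = X 4 ^ 4 + X 0 ^ 5 * X 4 + X 0 ^ 6 + X 1 ^ 3 + X 2 ^ 3 + X 3 ^ 7) :
    (Ideal.span (Set.range fun j : Fin 5 => Ideal.Quotient.mk (Ideal.span {f}) (X j)) : Ideal (MvPolynomial (Fin 5) k ⧸ Ideal.span {f})) ≠ ⊥ := by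
  intro h0
  have hmem : Ideal.Quotient.mk (Ideal.span {f}) (X 1) ∈
      (Ideal.span (Set.range fun j : Fin 5 => Ideal.Quotient.mk (Ideal.span {f}) (X j)) : Ideal (MvPolynomial (Fin 5) k ⧸ Ideal.span {f})) := Ideal.subset_span ⟨1, rfl⟩
  rw [h0, Ideal.mem_bot] at hmem
  exact (isPrime_and_mk_X_ne_zero k f hf).2 1 hmem

omit [CharP k 2] in
/-- `𝔪 ⊆ √K`: pure powers of all five variables lie in `K`. [folklore] -/
theorem span_floor_le_radical_K (f : MvPolynomial (Fin 5) k) :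
    Ideal.span (Set.range fun j : Fin 5 => Ideal.Quotient.mk (Ideal.span {f}) (X j)) ≤
      (Ideal.span ((fun e : Fin 5 →₀ ℕ => Ideal.Quotient.mk (Ideal.span {f}) (monomial e (1 : k))) '' (genSet 5 KL2 : Set (Fin 5 →₀ ℕ)))).radical := by
  rw [Ideal.span_le]
  rintro _ ⟨j, rfl⟩
  exact mk_X_mem_radical_span_K k (Ideal.span {f}) j


set_option maxHeartbeats 800000 in
-- ideal-sheaf products on the affine blow-up
/-- ★ **THE FIRST-STOREY BLOW-UP DATA** (the hypotheses `hπ₁ hJ hsuppτ hsuppK` of `FHalfRowOfTwoStoreys.fHalfConclusion_of_twoStoreys` for BED D): `π₁ = affineBlowup.π (𝔪·K)` is a blowing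
up of `X_D = Spec R̄` along `𝔪̃ · K̃`, `𝔪̃ · K̃ ≠ ⊥`, and the supports of `𝔪̃` and of `K̃` meet the generizations of the vertex `v` only in `v`.
[folklore; cite: StacksProject, Tag 0804; StacksProject, Tag 080A] -/
theorem storey1_isBlowup_data (f : MvPolynomial (Fin 5) k) (hf : f = X 4 ^ 4 + X 0 ^ 5 * X 4 + X 0 ^ 6 + X 1 ^ 3 + X 2 ^ 3 + X 3 ^ 7)
    (v : Spec (.of (MvPolynomial (Fin 5) k ⧸ Ideal.span {f})))
    (hv : v.asIdeal = Ideal.span (Set.range fun j : Fin 5 => Ideal.Quotient.mk (Ideal.span {f}) (X j))) :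
    IsBlowup (affineBlowup.π (Ideal.span (Set.range fun j : Fin 5 => Ideal.Quotient.mk (Ideal.span {f}) (X j)) *
        Ideal.span ((fun e : Fin 5 →₀ ℕ => Ideal.Quotient.mk (Ideal.span {f}) (monomial e (1 : k))) '' (genSet 5 KL2 : Set (Fin 5 →₀ ℕ)))))
      (affineBlowup.idealSheaf (Ideal.span (Set.range fun j : Fin 5 => Ideal.Quotient.mk (Ideal.span {f}) (X j))) *
        affineBlowup.idealSheaf (Ideal.span ((fun e : Fin 5 →₀ ℕ => Ideal.Quotient.mk (Ideal.span {f}) (monomial e (1 : k))) '' (genSet 5 KL2 : Set (Fin 5 →₀ ℕ))))) ∧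
    affineBlowup.idealSheaf (Ideal.span (Set.range fun j : Fin 5 => Ideal.Quotient.mk (Ideal.span {f}) (X j))) *
        affineBlowup.idealSheaf (Ideal.span ((fun e : Fin 5 →₀ ℕ => Ideal.Quotient.mk (Ideal.span {f}) (monomial e (1 : k))) '' (genSet 5 KL2 : Set (Fin 5 →₀ ℕ)))) ≠ ⊥ ∧
    (∀ y ∈ ((affineBlowup.idealSheaf (Ideal.span (Set.range fun j : Fin 5 => Ideal.Quotient.mk (Ideal.span {f}) (X j)))).support :
        Set (Spec (.of (MvPolynomial (Fin 5) k ⧸ Ideal.span {f})))), y ⤳ v → y = v) ∧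
    (∀ y ∈ ((affineBlowup.idealSheaf (Ideal.span ((fun e : Fin 5 →₀ ℕ => Ideal.Quotient.mk (Ideal.span {f}) (monomial e (1 : k))) ''
        (genSet 5 KL2 : Set (Fin 5 →₀ ℕ))))).support : Set (Spec (.of (MvPolynomial (Fin 5) k ⧸ Ideal.span {f})))), y ⤳ v → y = v) := by
  classical
  haveI := (isPrime_and_mk_X_ne_zero k f hf).1
  haveI : IsDomain (MvPolynomial (Fin 5) k ⧸ Ideal.span {f}) := Ideal.Quotient.isDomain _
  refine ⟨?_, ?_, ?_, ?_⟩
  · rw [← affineBlowup.idealSheaf_mul]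
    exact affineBlowup.isBlowup _
  · rw [← affineBlowup.idealSheaf_mul]
    exact affineBlowup.idealSheaf_ne_bot (mul_ne_zero (span_floor_ne_bot k f hf) (span_K_ne_bot k f hf))
  · intro y hy hyv
    rw [affineBlowup.support_idealSheaf] at hy
    have h1 : v.asIdeal ≤ y.asIdeal := by rw [hv]; exact fun a ha => hy ha
    have h2 : y.asIdeal ≤ v.asIdeal := (PrimeSpectrum.le_iff_specializes y v).mpr hyv
    exact PrimeSpectrum.ext (le_antisymm h2 h1)
  · intro y hy hyv
    rw [affineBlowup.support_idealSheaf] at hy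
    have hKy : Ideal.span ((fun e : Fin 5 →₀ ℕ => Ideal.Quotient.mk (Ideal.span {f}) (monomial e (1 : k))) '' (genSet 5 KL2 : Set (Fin 5 →₀ ℕ))) ≤ y.asIdeal :=
      fun a ha => hy ha
    have h1 : v.asIdeal ≤ y.asIdeal := by
      rw [hv]; exact (span_floor_le_radical_K k f).trans (y.2.radical_le_iff.mpr hKy)
    have h2 : y.asIdeal ≤ v.asIdeal := (PrimeSpectrum.le_iff_specializes y v).mpr hyv
    exact PrimeSpectrum.ext (le_antisymm h2 h1)

end Summit.ResolutionOfSingularities.ResolutionOfSingularities.Theorems.FInjectiveMacaulayfication.FDStorey1Centre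

end
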